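import Summits.ABC.ABC.Theorems.TwistAmplificationMazurKaneLawToolkitTame
import Summits.ABC.ABC.Theorems.TwistAmplificationMazurKaneLawSqrtLatticeDefs

-- Summit.ABC.ABC is the mandated summit-side namespace (single-conjunct summit); the lakefile sets the same option tree-wide.
set_option linter.dupNamespace false

/-!
# Certified⁺ boxes obey the box-level law at every exponent (crux stmt-ABC-2757, stub `toolkitCertifiedLaw`)

Stub S8 of the line `fibre-toolkit-lp-wall-map` (skeleton v3) for the crux
`Summit.ABC.ABC.Theses.TwistAmplification.MazurKaneLaw`. It generalises stub S3 `toolkitTame`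
(`TwistAmplificationMazurKaneLawToolkitTame`) in two directions: the certificate is the enlarged one
`Toolkit.CertifiedPlus = Certified ∨ SqrtLatticeCertifies` (the v2 kit plus the square-root lattice tool,
whose multiplicative forms `Toolkit.SqrtLatticeToolX`, `Toolkit.SqrtLatticeToolZ` enter as hypotheses next
to `Toolkit.DetTool`), and the exponent `θ` is arbitrary: `Toolkit.BoxLawAt (Toolkit.TameAt θ) s θ` says that
data admissible for `(s, ε′)` and certified⁺ at `θ + η/2` obey `B_M ≤ K · C₀^{θ+η}`. No linear programme is
solved: the certificate is the hypothesis, and the work is the exponent dictionary plus the endgame constants.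

* `shapeCount_swap` — `B_d(c₁, c₂, c₃; X, Y, Z) = B_d(c₂, c₁, c₃; Y, X, Z)` (the `y`-host case of the
  square-root lattice tool is the `x`-host case on the swapped datum);
* `sqrtLattice_linear` — the fifth dictionary entry (next to `AbcShapes.trivial_linear`,
  `AbcShapes.geometry_disjunction`, `AbcShapes.fourier_linear`, `det_linear`): the multiplicative bound
  `B ≤ #fibres · Dτ^{d+i+2} · (2 + 112 UᵢVᵢ/(c · offVal_H W))` (host `W` with coefficient `c`, freed
  variables `Uᵢ, Vᵢ`) reads, with `2 + 112t ≤ 114 max(1, t)`,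
  `log_Λ #fibres = (Σ α_W − Σ_H α_W) + (Σ α_U − α_{U,i}) + (Σ α_V − α_{V,i})` and
  `log_Λ (c · shapeVal W) = log_Λ (c · offVal_H W) + Σ_H (j+1) α_{W,j}`: either
  `D ≤ L − log_Λ(c · shapeVal W) + Σ_H j α_{W,j} + loss` or `D ≤ L − (Σ_H α_W + α_{U,i} + α_{V,i}) + loss`,
  `loss = (d+i+2) log_Λ Dτ + log_Λ 114`;
* `shapeCount_le_of_certifiedPlus` — one certificate⁺ at a time, with the same constant as
  `shapeCount_le_of_certified` (`d + i + 2 ≤ 3d + 3`, `log_Λ 114 ≤ log_Λ 27 + log_Λ 48`);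
* `toolkitCertifiedLaw` — the endgame of `toolkitTame` verbatim with `s − 1 ↦ θ`: `T = V₂ · 2C₀`,
  `Dτ = ⌊C_τ T^κ⌋`, `P₀ = max(1, N₀, 2 log((M+2)T³)) ≪ Λ^{η/4}`, `κ (3M+3) = η/4`, so `B ≤ K C₀^{θ+η}`.
-/

noncomputable section

open Finset
open Literature.NumberTheory.DiophantineGeometry
open Literature.NumberTheory.DiophantineGeometry.AbcShapes

namespace Summit.ABC.ABC.Theorems.MazurKaneLaw

open Summit.ABC.ABC.Theorems.MazurKaneLaw.Toolkit

/-- `B_d` is symmetric in the first two terms: `shapeCount c₁ c₂ c₃ X Y Z = shapeCount c₂ c₁ c₃ Y X Z`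
(swap `x ↔ y`: the equation commutes and the gcd of the three terms is symmetric). [folklore] -/
theorem shapeCount_swap {d : ℕ} (c₁ c₂ c₃ : ℕ) (X Y Z : Fin d → ℕ) :
    shapeCount c₁ c₂ c₃ X Y Z = shapeCount c₂ c₁ c₃ Y X Z := by
  classical
  -- adapted from Cruxes/MazurKaneLaw/Lines/critical_kloosterman_powerful_moduli.lean (`shapeCount_swap`)
  have key : ∀ (c₁ c₂ : ℕ) (X Y : Fin d → ℕ), ∀ t ∈ shapeTriples c₁ c₂ c₃ X Y Z,
      (t.2.1, t.1, t.2.2) ∈ shapeTriples c₂ c₁ c₃ Y X Z := by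
    intro c₁ c₂ X Y t ht
    simp only [shapeTriples, mem_filter, mem_product] at ht ⊢
    obtain ⟨⟨hx, hy, hz⟩, heq, hg⟩ := ht
    refine ⟨⟨hy, hx, hz⟩, by rw [← heq]; ring, ?_⟩
    rw [← hg, ← Nat.gcd_assoc, ← Nat.gcd_assoc, Nat.gcd_comm (c₂ * shapeProd t.2.1)]
  exact Finset.card_bij' (fun t _ => (t.2.1, t.1, t.2.2)) (fun t _ => (t.2.1, t.1, t.2.2)) (key c₁ c₂ X Y)
    (key c₂ c₁ Y X) (fun _ _ => rfl) (fun _ _ => rfl)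

/-- **The square-root lattice tool in exponent form** (fifth entry of the BBLT §6 dictionary). If
`B ≤ #subBox_H W · #subBox_{i} U · #subBox_{i} V · Dτ^{d+(i+2)} · (2 + 112 UᵢVᵢ/(c · offVal_H W))` (host `W`
with coefficient `c`, freed variables `Uᵢ, Vᵢ`), then with `D = log_Λ B`, `L = Σ α_W + Σ α_U + Σ α_V` and
`loss = (d+i+2) log_Λ Dτ + log_Λ 114`: either `D ≤ L − log_Λ(c · shapeVal W) + Σ_{j∈H} j α_{W,j} + loss`
(when `UᵢVᵢ > c · offVal_H W`: `2 + 112t ≤ 114t`, `log_Λ(c · shapeVal W) = log_Λ(c · offVal_H W) + Σ_H (j+1) α_{W,j}`)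
or `D ≤ L − (Σ_{j∈H} α_{W,j} + α_{U,i} + α_{V,i}) + loss` (else `2 + 112t ≤ 114`); in both cases
`log_Λ #fibres = (Σ α_W − Σ_H α_W) + (Σ α_U − α_{U,i}) + (Σ α_V − α_{V,i})` (`logb_card_subBox`). [folklore] -/
theorem sqrtLattice_linear {d : ℕ} {c : ℕ} (hc : 0 < c) {W U V : Fin d → ℕ} (hW : ∀ j, 0 < W j)
    (hU : ∀ j, 0 < U j) (hV : ∀ j, 0 < V j) {Dτ : ℕ} (hDτ : 1 ≤ Dτ) {Λ : ℝ} (hΛ : 1 < Λ) {B : ℝ}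
    (hB : 0 < B) (H : Finset (Fin d)) (i : Fin d)
    (hQ : B ≤ ((subBox H W).card * (subBox ({i} : Finset (Fin d)) U).card *
        (subBox ({i} : Finset (Fin d)) V).card : ℕ) * (Dτ : ℝ) ^ (d + ((i : ℕ) + 2)) *
        (2 + 112 * ((U i : ℝ) * V i) / ((c * offVal H W : ℕ) : ℝ))) :
    Real.logb Λ B ≤ (∑ j, expo Λ W j + ∑ j, expo Λ U j + ∑ j, expo Λ V j) -
        Real.logb Λ ((c * shapeVal W : ℕ) : ℝ) + ∑ j ∈ H, ((j : ℕ) : ℝ) * expo Λ W j +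
        ((((d : ℝ) + (i : ℕ) + 2)) * Real.logb Λ Dτ + Real.logb Λ 114) ∨
      Real.logb Λ B ≤ (∑ j, expo Λ W j + ∑ j, expo Λ U j + ∑ j, expo Λ V j) -
        (∑ j ∈ H, expo Λ W j + expo Λ U i + expo Λ V i) +
        (((d : ℝ) + (i : ℕ) + 2) * Real.logb Λ Dτ + Real.logb Λ 114) := by
  classical
  -- name the fibre count `F`, the host cofactor `A`, the ratio `t = UᵢVᵢ/A` and `G = F · Dτ^{d+i+2}`
  obtain ⟨F, hF⟩ : ∃ F : ℕ, F = (subBox H W).card * (subBox ({i} : Finset (Fin d)) U).card *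
      (subBox ({i} : Finset (Fin d)) V).card := ⟨_, rfl⟩
  obtain ⟨A, hA⟩ : ∃ A : ℕ, A = c * offVal H W := ⟨_, rfl⟩
  rw [← hF, ← hA] at hQ
  have hFc : ∀ (S : Finset (Fin d)) {R : Fin d → ℕ}, (∀ j, 0 < R j) → 0 < (subBox S R).card :=
    fun S R hR => by rw [card_subBox]; exact prod_pos fun j _ => hR j
  have hF0 : 0 < F := by rw [hF]; exact Nat.mul_pos (Nat.mul_pos (hFc H hW) (hFc _ hU)) (hFc _ hV)
  have hon : 0 < onVal H W := prod_pos fun j _ => pow_pos (hW j) _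
  have hoff : 0 < c * offVal H W := Nat.mul_pos hc (prod_pos fun j _ => pow_pos (hW j) _)
  have hA0 : 0 < A := by rw [hA]; exact hoff
  have hF' : (0 : ℝ) < F := by exact_mod_cast hF0
  have hA' : (0 : ℝ) < A := by exact_mod_cast hA0
  have hUi : (0 : ℝ) < U i := by exact_mod_cast hU i
  have hVi : (0 : ℝ) < V i := by exact_mod_cast hV i
  have hDτ' : (0 : ℝ) < Dτ := by exact_mod_cast hDτ
  obtain ⟨t, ht⟩ : ∃ t : ℝ, t = (U i : ℝ) * V i / A := ⟨_, rfl⟩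
  have ht0 : 0 < t := by rw [ht]; positivity
  obtain ⟨G, hG⟩ : ∃ G : ℝ, G = (F : ℝ) * (Dτ : ℝ) ^ (d + ((i : ℕ) + 2)) := ⟨_, rfl⟩
  have hG0 : 0 < G := by rw [hG]; positivity
  have hQ' : B ≤ G * (2 + 112 * t) := by rw [hG, ht, ← mul_div_assoc]; exact hQ
  -- logarithms of the ingredients
  have hlogF : Real.logb Λ (F : ℝ) = (∑ j, expo Λ W j - ∑ j ∈ H, expo Λ W j) +
      (∑ j, expo Λ U j - expo Λ U i) + (∑ j, expo Λ V j - expo Λ V i) := by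
    rw [hF, logb_natMul (Nat.mul_pos (hFc H hW) (hFc _ hU)) (hFc _ hV), logb_natMul (hFc H hW) (hFc _ hU),
      logb_card_subBox _ hW, logb_card_subBox _ hU, logb_card_subBox _ hV, sum_singleton, sum_singleton]
  have hlogG : Real.logb Λ G = Real.logb Λ F + ((d : ℝ) + (i : ℕ) + 2) * Real.logb Λ Dτ := by
    rw [hG, Real.logb_mul hF'.ne' (pow_pos hDτ' _).ne', Real.logb_pow]; push_cast; ring
  rcases le_or_gt t 1 with ht1 | ht1
  · -- `2 + 112 t ≤ 114`: the "+2" branch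
    right
    have h1 : B ≤ G * 114 := hQ'.trans (mul_le_mul_of_nonneg_left (by linarith) hG0.le)
    have h2 := Real.logb_le_logb_of_le hΛ hB h1
    rw [Real.logb_mul hG0.ne' (by norm_num), hlogG, hlogF] at h2
    linarith
  · -- `2 + 112 t ≤ 114 t`: the main branch
    left
    have h1 : B ≤ G * 114 * t := by
      rw [mul_assoc]; exact hQ'.trans (mul_le_mul_of_nonneg_left (by linarith) hG0.le)
    have h2 := Real.logb_le_logb_of_le hΛ hB h1
    rw [Real.logb_mul (mul_pos hG0 (by norm_num)).ne' ht0.ne', Real.logb_mul hG0.ne' (by norm_num), hlogG,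
      hlogF, ht, Real.logb_div (mul_pos hUi hVi).ne' hA'.ne', Real.logb_mul hUi.ne' hVi.ne'] at h2
    -- `log_Λ (c · shapeVal W) = log_Λ A + Σ_H (j+1) α_{W,j}`, `Σ_H (j+1) α = Σ_H j α + Σ_H α`
    have hsplit : Real.logb Λ ((c * shapeVal W : ℕ) : ℝ) =
        Real.logb Λ A + (∑ j ∈ H, ((j : ℕ) : ℝ) * expo Λ W j + ∑ j ∈ H, expo Λ W j) := by
      rw [shapeVal_eq_offVal_mul_onVal H W, ← mul_assoc, logb_natMul hoff hon, ← hA, logb_onVal _ hW,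
        ← sum_add_distrib]
      exact congrArg _ (sum_congr rfl fun j _ => by ring)
    rw [hsplit]
    simp only [expo] at h2 ⊢
    linarith

/-- **One certificate⁺ at a time**: under the standing hypotheses of the dictionary and the determinant tool at
every coordinate `i ≥ 1` for all `P ≥ P₀ ≥ 1` (as in `shapeCount_le_of_certified`), plus the square-root
lattice tool for the three hosts at every host set `H` and every `i ≥ 1` (`x`: `hqX`; `y`: `hqY`, stated for
the swapped datum `(c₂, c₁, c₃; Y, X, Z)`, cf. `shapeCount_swap`; `z`: `hqZ`), a certificate⁺
`CertifiedPlus Λ θ` gives the bound of `shapeCount_le_of_certified` with the same constant: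
`B ≤ Λ^θ · Dτ^{3d+3} · (2^{2d²+8} · V₂ · 27 · 48 · 24(d+1)(d+2)) · P₀` (for the lattice tool:
`sqrtLattice_linear`, `d + i + 2 ≤ 3d + 3` and `log_Λ 114 ≤ log_Λ 27 + log_Λ 48`). [folklore] -/
theorem shapeCount_le_of_certifiedPlus {d : ℕ} {c₁ c₂ c₃ : ℕ} (hc₁ : 0 < c₁) (hc₂ : 0 < c₂)
    (hc₃ : 0 < c₃) {X Y Z : Fin d → ℕ} (hX : ∀ i, 0 < X i) (hY : ∀ i, 0 < Y i) (hZ : ∀ i, 0 < Z i)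
    {T Dτ : ℕ} (hTX : c₁ * shapeVal (fun i => 2 * X i) ≤ T) (hTY : c₂ * shapeVal (fun i => 2 * Y i) ≤ T)
    (hTZ : c₃ * shapeVal (fun i => 2 * Z i) ≤ T) (hD : ∀ m : ℕ, m ≠ 0 → m ≤ T → m.divisors.card ≤ Dτ)
    {Λ : ℝ} (hΛ : 1 < Λ) (hB : 0 < shapeCount c₁ c₂ c₃ X Y Z) {C₀ : ℕ} (hC₀ : 1 ≤ C₀)
    (hΛC : Λ = 2 * C₀) (hC₀le : C₀ ≤ shapeVal (fun _ : Fin d => 2) * (c₃ * shapeVal Z)) {P₀ : ℝ}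
    (hP₀ : 1 ≤ P₀)
    (hdet : ∀ i : Fin d, 1 ≤ (i : ℕ) → ∀ P : ℝ, P₀ ≤ P →
      48 * ((X i : ℝ) * Y i * Z i) ≤
        ((c₁ * offVal ({i} : Finset (Fin d)) X : ℕ) : ℝ) * ((c₂ * offVal ({i} : Finset (Fin d)) Y : ℕ) : ℝ) *
          ((c₃ * offVal ({i} : Finset (Fin d)) Z : ℕ) : ℝ) * P ^ 3 →
      (shapeCount c₁ c₂ c₃ X Y Z : ℝ) ≤
        ((subBox ({i} : Finset (Fin d)) X).card * (subBox ({i} : Finset (Fin d)) Y).card *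
            (subBox ({i} : Finset (Fin d)) Z).card : ℕ) *
          (Dτ : ℝ) ^ (3 * ((i : ℕ) + 2)) * (24 * ((((i : ℕ) : ℝ) + 1) * (((i : ℕ) : ℝ) + 2))) * P)
    (hqX : ∀ (H : Finset (Fin d)) (i : Fin d), 1 ≤ (i : ℕ) →
      (shapeCount c₁ c₂ c₃ X Y Z : ℝ) ≤
        ((subBox H X).card * (subBox ({i} : Finset (Fin d)) Y).card *
            (subBox ({i} : Finset (Fin d)) Z).card : ℕ) *
          (Dτ : ℝ) ^ (d + ((i : ℕ) + 2)) * (2 + 112 * ((Y i : ℝ) * Z i) / ((c₁ * offVal H X : ℕ) : ℝ)))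
    (hqY : ∀ (H : Finset (Fin d)) (i : Fin d), 1 ≤ (i : ℕ) →
      (shapeCount c₂ c₁ c₃ Y X Z : ℝ) ≤
        ((subBox H Y).card * (subBox ({i} : Finset (Fin d)) X).card *
            (subBox ({i} : Finset (Fin d)) Z).card : ℕ) *
          (Dτ : ℝ) ^ (d + ((i : ℕ) + 2)) * (2 + 112 * ((X i : ℝ) * Z i) / ((c₂ * offVal H Y : ℕ) : ℝ)))
    (hqZ : ∀ (H : Finset (Fin d)) (i : Fin d), 1 ≤ (i : ℕ) →
      (shapeCount c₁ c₂ c₃ X Y Z : ℝ) ≤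
        ((subBox ({i} : Finset (Fin d)) X).card * (subBox ({i} : Finset (Fin d)) Y).card *
            (subBox H Z).card : ℕ) *
          (Dτ : ℝ) ^ (d + ((i : ℕ) + 2)) * (2 + 112 * ((X i : ℝ) * Y i) / ((c₃ * offVal H Z : ℕ) : ℝ)))
    {θ : ℝ} (hcert : CertifiedPlus Λ θ c₁ c₂ c₃ X Y Z) :
    (shapeCount c₁ c₂ c₃ X Y Z : ℝ) ≤
      Λ ^ θ * (Dτ : ℝ) ^ (3 * (d : ℝ) + 3) *
        ((2 : ℝ) ^ (2 * (d : ℝ) * d + 8) * ((shapeVal (fun _ : Fin d => 2) : ℕ) : ℝ) * 27 * 48 *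
          (24 * (((d : ℝ) + 1) * ((d : ℝ) + 2)))) * P₀ := by
  rcases hcert with hcert | ⟨H, i, hi, hQ⟩
  · exact shapeCount_le_of_certified hc₁ hc₂ hc₃ hX hY hZ hTX hTY hTZ hD hΛ hB hC₀ hΛC hC₀le hP₀ hdet hcert
  classical
  have hDτ1 : 1 ≤ Dτ := by
    have h1 : (1 : ℕ) ≤ T := le_trans (Nat.mul_pos hc₃ (shapeVal_pos fun i => Nat.mul_pos two_pos (hZ i))) hTZ
    simpa using hD 1 one_ne_zero h1
  have hΛ0 : 0 < Λ := by linarith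
  set V₂ : ℕ := shapeVal (fun _ : Fin d => 2) with hV₂
  have hV₂0 : 0 < V₂ := shapeVal_pos fun _ => two_pos
  have hV₂r : (0 : ℝ) < V₂ := by exact_mod_cast hV₂0
  have hDτr : (0 : ℝ) < Dτ := by exact_mod_cast hDτ1
  have hd0 : (0 : ℝ) ≤ d := Nat.cast_nonneg _
  have h24 : (1 : ℝ) ≤ 24 * (((d : ℝ) + 1) * ((d : ℝ) + 2)) := by nlinarith
  have hlD : 0 ≤ Real.logb Λ Dτ := Real.logb_nonneg hΛ (by exact_mod_cast hDτ1)
  have hl2 : 0 ≤ Real.logb Λ 2 := Real.logb_nonneg hΛ (by norm_num)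
  have hlV : 0 ≤ Real.logb Λ V₂ := Real.logb_nonneg hΛ (by exact_mod_cast hV₂0)
  have hl24 : 0 ≤ Real.logb Λ (24 * (((d : ℝ) + 1) * ((d : ℝ) + 2))) := Real.logb_nonneg hΛ h24
  have hlP : 0 ≤ Real.logb Λ P₀ := Real.logb_nonneg hΛ hP₀
  have hddl2 : 0 ≤ (2 * (d : ℝ) * d + 8) * Real.logb Λ 2 := by positivity
  have hP₀0 : 0 < P₀ := by linarith
  have h114 : Real.logb Λ 114 ≤ Real.logb Λ 27 + Real.logb Λ 48 := by
    rw [← Real.logb_mul (by norm_num) (by norm_num)]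
    exact Real.logb_le_logb_of_le hΛ (by norm_num) (by norm_num)
  have hBr : (0 : ℝ) < shapeCount c₁ c₂ c₃ X Y Z := by exact_mod_cast hB
  have hL : radExp Λ X Y Z = ∑ i, expo Λ X i + ∑ i, expo Λ Y i + ∑ i, expo Λ Z i := by
    rw [radExp, sum_add_distrib, sum_add_distrib]
  have hid : ((i : ℕ) : ℝ) + 1 ≤ d := by exact_mod_cast Nat.succ_le_of_lt i.isLt
  have hilD : ((d : ℝ) + (i : ℕ) + 2) * Real.logb Λ Dτ ≤ (3 * (d : ℝ) + 3) * Real.logb Λ Dτ :=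
    mul_le_mul_of_nonneg_right (by linarith) hlD
  -- the additive form `log_Λ B ≤ θ + losses`
  have hadd : Real.logb Λ (shapeCount c₁ c₂ c₃ X Y Z) ≤
      θ + ((3 * (d : ℝ) + 3) * Real.logb Λ Dτ + (2 * (d : ℝ) * d + 8) * Real.logb Λ 2 + Real.logb Λ V₂ +
        Real.logb Λ 27 + Real.logb Λ 48 + Real.logb Λ (24 * (((d : ℝ) + 1) * ((d : ℝ) + 2))) +
        Real.logb Λ P₀) := by
    rw [hL] at hQ
    rcases hQ with ⟨h1, h2⟩ | ⟨h1, h2⟩ | ⟨h1, h2⟩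
    · -- host `x`
      have hq := sqrtLattice_linear hc₁ hX hY hZ hDτ1 hΛ hBr H i (hqX H i hi)
      rcases hq with hq | hq <;> linarith
    · -- host `y`: the `x`-tool on the swapped datum
      have hBr' : (0 : ℝ) < shapeCount c₂ c₁ c₃ Y X Z := by rw [← shapeCount_swap c₁ c₂ c₃ X Y Z]; exact hBr
      have hq := sqrtLattice_linear hc₂ hY hX hZ hDτ1 hΛ hBr' H i (hqY H i hi)
      rw [← shapeCount_swap c₁ c₂ c₃ X Y Z] at hq
      rcases hq with hq | hq <;> linarith
    · -- host `z`
      have hq' := hqZ H i hi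
      rw [show (subBox ({i} : Finset (Fin d)) X).card * (subBox ({i} : Finset (Fin d)) Y).card *
          (subBox H Z).card = (subBox H Z).card * (subBox ({i} : Finset (Fin d)) X).card *
          (subBox ({i} : Finset (Fin d)) Y).card from by ring] at hq'
      have hq := sqrtLattice_linear hc₃ hZ hX hY hDτ1 hΛ hBr H i hq'
      rcases hq with hq | hq <;> linarith
  -- exponentiate
  have hpowlog : ∀ {x : ℝ} (c : ℝ), 0 < x → Λ ^ (c * Real.logb Λ x) = x ^ c := fun c hx => by
    rw [mul_comm, Real.rpow_mul hΛ0.le, Real.rpow_logb hΛ0 hΛ.ne' hx]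
  have hpl : ∀ {x : ℝ}, 0 < x → Λ ^ Real.logb Λ x = x := fun hx => Real.rpow_logb hΛ0 hΛ.ne' hx
  calc (shapeCount c₁ c₂ c₃ X Y Z : ℝ) = Λ ^ Real.logb Λ (shapeCount c₁ c₂ c₃ X Y Z) :=
        (Real.rpow_logb hΛ0 hΛ.ne' hBr).symm
    _ ≤ _ := Real.rpow_le_rpow_of_exponent_le hΛ.le hadd
    _ = _ := by
        simp only [Real.rpow_add hΛ0]
        rw [hpowlog _ hDτr, hpowlog _ two_pos, hpl hV₂r, hpl (by norm_num : (0 : ℝ) < 27),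
          hpl (by norm_num : (0 : ℝ) < 48), hpl (by positivity), hpl hP₀0]
        ring

/-- **Stub S8 (`toolkitCertifiedLaw`): with the determinant tool and the two square-root lattice tools,
CERTIFIED⁺ boxes obey the box-level law at every exponent `θ`.** For `η > 0` (any `ε₀`, here `1/4`) and `ε′`,
`M = numShapes ε′`, put `T = V₂ · 2C₀`, `Dτ = ⌊C_τ T^κ⌋` with `κ(3M+3) = η/4` (divisor bound),
`P₀ = max(1, N₀, 2 log((M+2)T³)) ≤ P_c Λ^{η/4}` (`log x ≤ x^{η/12}/(η/12)`); then
`shapeCount_le_of_certifiedPlus` at the certificate `CertifiedPlus (2C₀) (θ + η/2)` (the `x`-tool on the datum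
and on the swapped datum, the `z`-tool on the datum) gives `B ≤ Λ^{θ+η/2} Dτ^{3M+3} E P₀ ≤ K C₀^{θ+η}` with
`K = 2^{θ+η} C_τ^{3M+3} V₂^{η/4} E P_c` — the endgame of `toolkitTame` with `s − 1 ↦ θ` (it never used
`θ = s − 1`). [folklore] -/
theorem toolkitCertifiedLaw : Summit.ABC.ABC.Theorems.MazurKaneLaw.Toolkit.DetTool → Summit.ABC.ABC.Theorems.MazurKaneLaw.Toolkit.SqrtLatticeToolX → Summit.ABC.ABC.Theorems.MazurKaneLaw.Toolkit.SqrtLatticeToolZ → ∀ s θ : ℝ, Summit.ABC.ABC.Theorems.MazurKaneLaw.Toolkit.BoxLawAt (Summit.ABC.ABC.Theorems.MazurKaneLaw.Toolkit.TameAt θ) s θ := by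
  rintro ⟨N₀, hN₀, hdet⟩ hQX hQZ s θ η hη
  refine ⟨1 / 4, by norm_num, fun ε' _ _ => ?_⟩
  -- work in a general dimension `M` (instantiated at `numShapes ε'`)
  suffices h : ∀ M : ℕ, ∃ K : ℝ, 0 ≤ K ∧ ∀ (C₀ c₁ c₂ c₃ : ℕ) (X Y Z : Fin M → ℕ),
      Admissible s ε' C₀ c₁ c₂ c₃ X Y Z → TameAt θ M s (η / 2) C₀ c₁ c₂ c₃ X Y Z →
        (shapeCount c₁ c₂ c₃ X Y Z : ℝ) ≤ K * (C₀ : ℝ) ^ (θ + η) from h _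
  intro M
  classical
  -- the constants `V₂`, `a = 3M + 3`, `κ = η / (4a)`, `C_τ`, `κ₂ = η / 12`, `P_c`, `E`, `K`
  obtain ⟨V2, hV2⟩ : ∃ V : ℕ, V = shapeVal (fun _ : Fin M => 2) := ⟨_, rfl⟩
  have hV2pos : 0 < V2 := by rw [hV2]; exact shapeVal_pos fun _ => two_pos
  have hV2r : (0 : ℝ) < V2 := by exact_mod_cast hV2pos
  obtain ⟨a, ha⟩ : ∃ a : ℝ, a = 3 * (M : ℝ) + 3 := ⟨_, rfl⟩
  have ha0 : 0 < a := by rw [ha]; positivity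
  obtain ⟨κ, hκ⟩ : ∃ κ : ℝ, κ = η / 4 / a := ⟨_, rfl⟩
  have hκ0 : 0 < κ := by rw [hκ]; positivity
  have hκa : κ * a = η / 4 := by rw [hκ]; field_simp
  obtain ⟨Cτ, hCτ1, hCτ⟩ := Literature.NumberTheory.Sieve.exists_card_divisors_le_mul_rpow hκ0
  have hCτ0 : 0 < Cτ := by linarith
  obtain ⟨κ₂, hκ₂⟩ : ∃ κ₂ : ℝ, κ₂ = η / 12 := ⟨_, rfl⟩
  have hκ₂0 : 0 < κ₂ := by rw [hκ₂]; positivity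
  obtain ⟨G, hG⟩ : ∃ G : ℝ, G = ((M : ℝ) + 2) * (V2 : ℝ) ^ 3 := ⟨_, rfl⟩
  have hG0 : 0 < G := by rw [hG]; positivity
  obtain ⟨Pc, hPc⟩ : ∃ Pc : ℝ, Pc = 1 + N₀ + 2 * (G ^ κ₂ / κ₂) := ⟨_, rfl⟩
  have hPc1 : 1 + N₀ ≤ Pc := by rw [hPc]; linarith [show 0 ≤ 2 * (G ^ κ₂ / κ₂) by positivity]
  have hPc0 : 0 < Pc := by linarith
  obtain ⟨E, hE⟩ : ∃ E : ℝ, E = (2 : ℝ) ^ (2 * (M : ℝ) * M + 8) * (V2 : ℝ) * 27 * 48 *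
      (24 * (((M : ℝ) + 1) * ((M : ℝ) + 2))) := ⟨_, rfl⟩
  have hE0 : 0 < E := by rw [hE]; positivity
  obtain ⟨K, hK⟩ : ∃ K : ℝ, K = (2 : ℝ) ^ (θ + η) * (Cτ ^ a * (V2 : ℝ) ^ (η / 4) * E * Pc) := ⟨_, rfl⟩
  have hK0 : 0 ≤ K := by rw [hK]; positivity
  refine ⟨K, hK0, fun C₀ c₁ c₂ c₃ X Y Z hA hTame => ?_⟩
  obtain ⟨hC₀1, hc₁, hc₂, hc₃, -, -, -, hXp, hYp, hZp, -, hvX, hvY, hvZ, hC₀le⟩ := hA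
  have hC₀ : (1 : ℝ) ≤ C₀ := by exact_mod_cast hC₀1
  rcases Nat.eq_zero_or_pos (shapeCount c₁ c₂ c₃ X Y Z) with hB0 | hBpos
  · rw [hB0, Nat.cast_zero]; positivity
  -- `Λ = 2C₀`, `T = V₂ · 2C₀`, `Dτ = ⌊C_τ T^κ⌋`
  obtain ⟨Λ, hΛdef⟩ : ∃ Λ : ℝ, Λ = 2 * C₀ := ⟨_, rfl⟩
  have hΛ : 1 < Λ := by rw [hΛdef]; linarith
  have hΛ0 : 0 < Λ := by linarith
  have hcert : CertifiedPlus Λ (θ + η / 2) c₁ c₂ c₃ X Y Z := by rw [hΛdef]; exact hTame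
  obtain ⟨T, hT⟩ : ∃ T : ℕ, T = V2 * (2 * C₀) := ⟨_, rfl⟩
  have hT1 : 1 ≤ T := by rw [hT]; exact Nat.mul_pos hV2pos (by omega)
  have hT' : (T : ℝ) = V2 * Λ := by rw [hT, hΛdef]; push_cast; ring
  have hTval : ∀ {c : ℕ} {W : Fin M → ℕ}, c * shapeVal W ≤ 2 * C₀ →
      c * shapeVal (fun i => 2 * W i) ≤ T := by
    intro c W hW
    calc c * shapeVal (fun i => 2 * W i) = V2 * (c * shapeVal W) := by
          rw [show (fun i => 2 * W i) = fun i => (fun _ : Fin M => 2) i * W i from rfl,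
            shapeVal_mul, ← hV2]; ring
      _ ≤ V2 * (2 * C₀) := Nat.mul_le_mul_left _ hW
      _ = T := hT.symm
  obtain ⟨Dτ, hDτ⟩ : ∃ D : ℕ, D = ⌊Cτ * (T : ℝ) ^ κ⌋₊ := ⟨_, rfl⟩
  have hD : ∀ n : ℕ, n ≠ 0 → n ≤ T → n.divisors.card ≤ Dτ := by
    intro n hn hnT
    rw [hDτ]
    refine Nat.le_floor ((hCτ n hn).trans ?_)
    exact mul_le_mul_of_nonneg_left (Real.rpow_le_rpow (Nat.cast_nonneg _)
      (by exact_mod_cast hnT) hκ0.le) hCτ0.le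
  have hDreal : (Dτ : ℝ) ≤ Cτ * (T : ℝ) ^ κ := by rw [hDτ]; exact Nat.floor_le (by positivity)
  -- `P₀ = max(1, N₀, 2 log((M+2) T³)) ≤ P_c Λ^{η/4}`
  obtain ⟨P₀, hP₀⟩ : ∃ P₀ : ℝ, P₀ = max 1 (max N₀ (2 * Real.log (((M : ℝ) + 2) * (T : ℝ) ^ 3))) := ⟨_, rfl⟩
  have hP₀1 : 1 ≤ P₀ := by rw [hP₀]; exact le_max_left _ _
  have hN₀P₀ : N₀ ≤ P₀ := by rw [hP₀]; exact (le_max_left _ _).trans (le_max_right _ _)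
  have hΛη : 1 ≤ Λ ^ (η / 4) := Real.one_le_rpow hΛ.le (by positivity)
  have hP₀le : P₀ ≤ Pc * Λ ^ (η / 4) := by
    have hPcΛ : Pc ≤ Pc * Λ ^ (η / 4) := le_mul_of_one_le_right hPc0.le hΛη
    have h3 : Λ ^ (3 : ℝ) = Λ ^ (3 : ℕ) := by exact_mod_cast Real.rpow_natCast Λ 3
    have hx : ((M : ℝ) + 2) * (T : ℝ) ^ 3 = G * Λ ^ (3 : ℝ) := by rw [hG, hT', h3]; ring
    have hlog : Real.log (((M : ℝ) + 2) * (T : ℝ) ^ 3) ≤ (G ^ κ₂ / κ₂) * Λ ^ (η / 4) := by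
      refine (Real.log_le_rpow_div (by positivity) hκ₂0).trans_eq ?_
      rw [hx, Real.mul_rpow hG0.le (by positivity), ← Real.rpow_mul hΛ0.le,
        show (3 : ℝ) * κ₂ = η / 4 by rw [hκ₂]; ring]
      ring
    rw [hP₀]
    refine max_le (le_trans (by linarith) hPcΛ) (max_le (le_trans (by linarith) hPcΛ) ?_)
    calc 2 * Real.log (((M : ℝ) + 2) * (T : ℝ) ^ 3) ≤ 2 * (G ^ κ₂ / κ₂) * Λ ^ (η / 4) := by linarith
      _ ≤ Pc * Λ ^ (η / 4) := by
          refine mul_le_mul_of_nonneg_right ?_ (by positivity)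
          rw [hPc]; linarith
  -- the determinant tool at every coordinate, for `P ≥ P₀`
  have hlogi : ∀ (i : Fin M) {P : ℝ}, P₀ ≤ P →
      2 * Real.log ((((i : ℕ) : ℝ) + 2) * (T : ℝ) ^ 3) ≤ P := by
    intro i P hP
    have hi : (((i : ℕ) : ℝ) + 2) * (T : ℝ) ^ 3 ≤ ((M : ℝ) + 2) * (T : ℝ) ^ 3 := by
      have : ((i : ℕ) : ℝ) ≤ M := by exact_mod_cast i.isLt.le
      nlinarith [show (0 : ℝ) ≤ (T : ℝ) ^ 3 by positivity]
    have hlogP₀ : 2 * Real.log (((M : ℝ) + 2) * (T : ℝ) ^ 3) ≤ P₀ := by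
      rw [hP₀]; exact (le_max_right _ _).trans (le_max_right _ _)
    have := Real.log_le_log (by positivity) hi
    linarith
  -- one certificate⁺ at a time (the `x`-tool on the datum and on the swapped datum, the `z`-tool on the datum)
  have hmul := shapeCount_le_of_certifiedPlus hc₁ hc₂ hc₃ hXp hYp hZp (hTval hvX) (hTval hvY) (hTval hvZ)
    hD hΛ hBpos hC₀1 hΛdef hC₀le hP₀1
    (fun i hi P hP h48 => hdet hc₁ hc₂ hc₃ X Y Z hXp hYp hZp (hTval hvX) (hTval hvY) (hTval hvZ) hD
      i hi P (hN₀P₀.trans hP) (hlogi i hP) h48)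
    (hQX hc₁ hc₂ hc₃ X Y Z hXp hYp hZp (hTval hvX) (hTval hvY) (hTval hvZ) hD)
    (hQX hc₂ hc₁ hc₃ Y X Z hYp hXp hZp (hTval hvY) (hTval hvX) (hTval hvZ) hD)
    (hQZ hc₁ hc₂ hc₃ X Y Z hXp hYp hZp (hTval hvX) (hTval hvY) (hTval hvZ) hD) hcert
  rw [← hV2, ← ha, ← hE] at hmul
  -- `Dτ^a ≤ C_τ^a V₂^{η/4} Λ^{η/4}`
  have hD1 : 1 ≤ Dτ := by simpa using hD 1 one_ne_zero hT1
  have hDpos : (0 : ℝ) < Dτ := by exact_mod_cast hD1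
  have hDa : (Dτ : ℝ) ^ a ≤ Cτ ^ a * (V2 : ℝ) ^ (η / 4) * Λ ^ (η / 4) := by
    calc (Dτ : ℝ) ^ a ≤ (Cτ * (T : ℝ) ^ κ) ^ a := Real.rpow_le_rpow (Nat.cast_nonneg _) hDreal ha0.le
      _ = Cτ ^ a * (T : ℝ) ^ (η / 4) := by
          rw [Real.mul_rpow hCτ0.le (by positivity), ← Real.rpow_mul (Nat.cast_nonneg _), hκa]
      _ = Cτ ^ a * (V2 : ℝ) ^ (η / 4) * Λ ^ (η / 4) := by
          rw [hT', Real.mul_rpow hV2r.le hΛ0.le, mul_assoc]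
  -- `Λ^{θ+η/2} Λ^{η/4} Λ^{η/4} = 2^{θ+η} C₀^{θ+η}`
  have hΛsplit : Λ ^ (θ + η / 2) * Λ ^ (η / 4) * Λ ^ (η / 4) =
      (2 : ℝ) ^ (θ + η) * (C₀ : ℝ) ^ (θ + η) := by
    rw [← Real.rpow_add hΛ0, ← Real.rpow_add hΛ0, show θ + η / 2 + η / 4 + η / 4 = θ + η by ring,
      hΛdef, Real.mul_rpow zero_le_two (by linarith)]
  have hθ0 : (0 : ℝ) ≤ Λ ^ (θ + η / 2) := by positivity
  calc (shapeCount c₁ c₂ c₃ X Y Z : ℝ) ≤ Λ ^ (θ + η / 2) * (Dτ : ℝ) ^ a * E * P₀ := hmul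
    _ ≤ Λ ^ (θ + η / 2) * (Cτ ^ a * (V2 : ℝ) ^ (η / 4) * Λ ^ (η / 4)) * E * (Pc * Λ ^ (η / 4)) :=
        mul_le_mul (mul_le_mul_of_nonneg_right (mul_le_mul_of_nonneg_left hDa hθ0) hE0.le) hP₀le
          (by linarith) (by positivity)
    _ = Cτ ^ a * (V2 : ℝ) ^ (η / 4) * E * Pc * (Λ ^ (θ + η / 2) * Λ ^ (η / 4) * Λ ^ (η / 4)) := by
        ring
    _ = K * (C₀ : ℝ) ^ (θ + η) := by rw [hΛsplit, hK]; ring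

end Summit.ABC.ABC.Theorems.MazurKaneLaw

end
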